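import Summits.CriticalPhenomena.PercolationContinuityZ3.Theorems.PercNearOneGluingNoHeavyQuantSliceDeepLowsWitness
import Summits.CriticalPhenomena.PercolationContinuityZ3.Theorems.PercNearOneGluingNoHeavyQuantLawDecFlowsDecomposition
import HarnessLib

/-!
# QUANT lane R8, T-DEC: **SL-λ* FOR ANY NUMBER OF DEEP LOWS AND WINDOW MIDS, `g ≥ 1/2`** — the theorem (LEAD-NOTES-G23 N49, Theorem A)

builds on p205010 (kernel theorem, internal audit signed; external expert review pending)

Support file (`--supports stmt-CriticalPhenomena-4575`), QUANT lane lead seat prim-quant-lead (gen 23), rung R8 of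
`run/shared/lean/prim/quant/LADDER.md`.  Theorems only; standard axioms, no sorries.  Fourth and last file of Theorem A
(`…QuantSliceDeepLowsBudget` → `…Pool` → `…Witness` → this).

**THEOREM A** (`slice_decAtT_of_deepLows`; flow forms `slice_isFlowAtT_of_deepLows`, `slice_flowAtT_of_deepLows`).  Probability law `ν` on
`{0..M}`, floor `0 < x < 1`, target `T`, blob `(a, g)` with `1 ≤ a ≤ j′`, `x ≤ g ≤ 1`, **`1/2 ≤ g`**, raised target `T′ = T + a·g`, layers
`λ ≤ j′ ≤ λ + a`.  SUPPORT (any number of atoms of each kind): every charged atom `k ≤ j′` with `2k < T` is a DEEP low (`2(k+a) < T′` and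
`k + a ≤ j′`); every charged non-low atom `k ≤ λ` has `2k ≤ T′` (band-like); every charged atom `k ∈ (λ, j′]` has `2k > T′` (true window mid);
giants `> j′` unrestricted.  THEN `DECAtT x T j′ M ν ∧ DECAtT x T λ M ν ⟹ DECAtT x T′ j′ (M + a) (slice ν a g)`.
With `λ = λ*` := (least true window mid) − 1 the band / window-mid conditions are automatic (lead g22 N48 (1): band atoms lie below every
true window mid), so this is CONJECTURE SL-λ* (README V253) on the whole family "deep lows + band atoms + near straddler mids + giants" —
the family of census-2's refutation of two-layer SL ({2, 4, 6, 8}) with arbitrarily many lows and mids — for every floor `x ≥ 1/2`.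
It supersedes the Case 1 / Case 2 (`g ≥ 1/2`) split of the single-low blueprint (N48 (3)) by one scaling factor `σ_l` per low.
NOT COVERED (open, router-localised in prim-quant-lead-g23/explore/g23_router.py): true mids `≤ j′ − a`, shallow lows, window lows above `λ`,
and `g < 1/2`.
* `sum_dlAd_restrict`, **`dlFlow_ships`** (given the pool budget `hPB`) (every low position of the slice is shipped exactly; an empty pool forces every source to vanish by
  `pool_budget`), **`slice_isFlowAtT_of_deepLows_core`** (pool budget as a hypothesis — the plug for Theorem A⁺/C) / **`slice_isFlowAtT_of_deepLows`** (budget = `pool_budget`; nonnegativity, support/compatibility — verticals by `T ≤ 2q` and `g < 1`, anti-diagonals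
  by `antiDiag_compatible` —, shipping, capacity = `loadV_le + loadA_le + loadP_le ≤ slice`, the vertical and the row-1 pool never charging
  the same atom `p − a` by the window-mid hypothesis), `slice_flowAtT_of_deepLows`, `slice_decAtT_of_deepLows`.

EVIDENCE before the proof: exact routing check prim-quant-lead-g23/explore/g23_thmA.py 198/198 (LP-concordant).  [this work]; nothing here is
cited as a published result.  The gluing rows served [cite: KozmaNitzan2024, Conjecture 3 (p. 15)]; product measure [cite: Grimmett1999, §1.3 p. 10].
-/

noncomputable section

namespace Summit.CriticalPhenomena.PercolationContinuityZ3.Theorems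

namespace Quant

open Finset

namespace LawDec

/-! ### The shipping identity and the theorem -/

section Main

variable (x T g : ℝ) (j' M a lam : ℕ) (ν : ℕ → ℝ) (f0 : ℕ → ℕ → ℝ)

/-- anti-diagonal sums do not see positions above `M`: `Σ_{p ≤ N, p ≤ j′} dlAd l p = Σ_{p ≤ j′} dlAd l p` for `N ≥ M`. -/
theorem sum_dlAd_restrict (hf0 : IsFlowAtT x T j' M ν f0) (l N : ℕ) (hN : M ≤ N) :
    ∑ p ∈ Finset.range (N + 1), (if p ≤ j' then dlAd x T g j' a ν f0 l p else 0)
      = ∑ p ∈ Finset.range (j' + 1), dlAd x T g j' a ν f0 l p := by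
  have hzero : ∀ p, M < p → dlAd x T g j' a ν f0 l p = 0 := by
    intro p hp
    refine dlAd_eq_zero x T g j' a ν f0 l p ?_
    rintro ⟨-, hflp⟩
    exact absurd (hf0.2.1 l p hflp).2.2.1 (by omega)
  set K := max N j' with hK
  have e1 : ∑ p ∈ Finset.range (N + 1), (if p ≤ j' then dlAd x T g j' a ν f0 l p else 0)
      = ∑ p ∈ Finset.range (K + 1), (if p ≤ j' then dlAd x T g j' a ν f0 l p else 0) := by
    refine Finset.sum_subset (Finset.range_mono (by omega)) fun p hp hnp => ?_
    rw [Finset.mem_range] at hp hnp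
    split_ifs with hpj
    · exact hzero p (by omega)
    · rfl
  have e2 : ∑ p ∈ Finset.range (j' + 1), dlAd x T g j' a ν f0 l p
      = ∑ p ∈ Finset.range (K + 1), (if p ≤ j' then dlAd x T g j' a ν f0 l p else 0) := by
    rw [← Finset.sum_subset (Finset.range_mono (show j' + 1 ≤ K + 1 by omega))
      (f := fun p => if p ≤ j' then dlAd x T g j' a ν f0 l p else 0)]
    · refine Finset.sum_congr rfl fun p hp => ?_
      rw [if_pos (Nat.lt_succ_iff.1 (Finset.mem_range.1 hp))]
    · intro p _ hnp
      rw [Finset.mem_range] at hnp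
      rw [if_neg (by omega)]
  rw [e1, e2]

/-- **THE SHIPPING IDENTITY**: every low position `q ≤ j′`, `2q < T′` of the slice is shipped exactly: `Σ_{p ≤ M+a} dlFlow q p = slice ν a g q`.
[this work] -/
theorem dlFlow_ships (hx0 : 0 < x) (hx1 : x < 1) (hxg : x ≤ g) (hg1 : g ≤ 1)
    (ha : 1 ≤ a) (haj : a ≤ j') (hν : ∀ k, 0 ≤ ν k) (hνM : ∀ k, M < k → ν k = 0)
    (hf0 : IsFlowAtT x T j' M ν f0)
    (hPB : x / (1 - x) * ∑ l ∈ Finset.range (j' + 1), (if 2 * (l : ℝ) < T then dlRest x T g j' a ν f0 l else 0)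
      ≤ dlPoolTot g j' M lam ν)
    (q : ℕ) (hqj : q ≤ j') (hq : 2 * (q : ℝ) < T + (a : ℝ) * g) :
    ∑ p ∈ Finset.range (M + a + 1), dlFlow x T g j' M a lam ν f0 q p = slice ν a g q := by
  have hg0 : 0 ≤ g := hx0.le.trans hxg
  have hu : 0 < x / (1 - x) := div_pos hx0 (by linarith)
  -- open the guard
  have e : ∀ p ∈ Finset.range (M + a + 1), dlFlow x T g j' M a lam ν f0 q p
      = (if T ≤ 2 * (q : ℝ) ∧ p = q + a then (1 - g) * ν q else 0)
        + (if a ≤ q ∧ p ≤ j' then dlAd x T g j' a ν f0 (q - a) p else 0)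
        + dlSrc x T g j' a ν f0 q * dlPool g j' a lam ν p / dlPoolTot g j' M lam ν := by
    intro p hp
    unfold dlFlow
    rw [if_pos ⟨hqj, hq, Nat.lt_succ_iff.1 (Finset.mem_range.1 hp)⟩]
  rw [Finset.sum_congr rfl e, Finset.sum_add_distrib, Finset.sum_add_distrib]
  -- the vertical
  have hV : ∑ p ∈ Finset.range (M + a + 1), (if T ≤ 2 * (q : ℝ) ∧ p = q + a then (1 - g) * ν q else 0)
      = (if T ≤ 2 * (q : ℝ) then (1 - g) * ν q else 0) := by
    by_cases hb : T ≤ 2 * (q : ℝ)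
    · rw [if_pos hb]
      have e1 : ∀ p ∈ Finset.range (M + a + 1), (if T ≤ 2 * (q : ℝ) ∧ p = q + a then (1 - g) * ν q else 0)
          = (if p = q + a then (1 - g) * ν q else 0) := by
        intro p _
        by_cases hpq : p = q + a
        · rw [if_pos ⟨hb, hpq⟩, if_pos hpq]
        · rw [if_neg (fun h => hpq h.2), if_neg hpq]
      rw [Finset.sum_congr rfl e1, Finset.sum_ite_eq']
      by_cases hqM : q ≤ M
      · rw [if_pos (Finset.mem_range.2 (by omega))]
      · rw [hνM q (by omega), mul_zero]
        split_ifs <;> rfl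
    · rw [if_neg hb]
      exact Finset.sum_eq_zero fun p _ => by rw [if_neg (fun h => hb h.1)]
  -- the anti-diagonals
  have hA : ∑ p ∈ Finset.range (M + a + 1), (if a ≤ q ∧ p ≤ j' then dlAd x T g j' a ν f0 (q - a) p else 0)
      = (if a ≤ q then ∑ m ∈ Finset.range (j' + 1), dlAd x T g j' a ν f0 (q - a) m else 0) := by
    by_cases haq : a ≤ q
    · rw [if_pos haq, ← sum_dlAd_restrict x T g j' M a ν f0 hf0 (q - a) (M + a) (by omega)]
      refine Finset.sum_congr rfl fun p _ => ?_
      by_cases hpj : p ≤ j'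
      · rw [if_pos ⟨haq, hpj⟩, if_pos hpj]
      · rw [if_neg (fun h => hpj h.2), if_neg hpj]
    · rw [if_neg haq]
      exact Finset.sum_eq_zero fun p _ => by rw [if_neg (fun h => haq h.1)]
  -- the pool
  have hP : ∑ p ∈ Finset.range (M + a + 1), dlSrc x T g j' a ν f0 q * dlPool g j' a lam ν p / dlPoolTot g j' M lam ν
      = dlSrc x T g j' a ν f0 q := by
    rw [← Finset.sum_div, ← Finset.mul_sum, sum_dlPool g j' M a lam ν hνM]
    by_cases htot : dlPoolTot g j' M lam ν = 0
    · -- empty pool: then nothing is pool-bound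
      rw [htot, div_zero]
      have hS := sum_dlSrc_le x T g j' a ν f0 ha haj hg0 hg1 hν
      have hB' : ∑ l ∈ Finset.range (j' + 1), (if 2 * (l : ℝ) < T then dlRest x T g j' a ν f0 l else 0) ≤ 0 := by
        have : x / (1 - x) * ∑ l ∈ Finset.range (j' + 1),
            (if 2 * (l : ℝ) < T then dlRest x T g j' a ν f0 l else 0) ≤ 0 := by
          rw [htot] at hPB; exact hPB
        by_contra hpos
        exact absurd this (not_le.2 (mul_pos hu (not_le.1 hpos)))
      have hz : ∑ q' ∈ Finset.range (j' + 1),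
          (if 2 * (q' : ℝ) < T + (a : ℝ) * g then dlSrc x T g j' a ν f0 q' else 0) = 0 :=
        le_antisymm (hS.trans hB') (Finset.sum_nonneg fun q' _ => by
          split_ifs
          · exact dlSrc_nonneg x T g j' a ν f0 hg0 hg1 hν q'
          · exact le_rfl)
      have hterm := (Finset.sum_eq_zero_iff_of_nonneg (fun q' _ => by
          show (0 : ℝ) ≤ (if 2 * (q' : ℝ) < T + (a : ℝ) * g then dlSrc x T g j' a ν f0 q' else 0)
          split_ifs
          · exact dlSrc_nonneg x T g j' a ν f0 hg0 hg1 hν q'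
          · exact le_rfl)).1 hz q (Finset.mem_range.2 (by omega))
      rw [if_pos hq] at hterm
      rw [hterm]
    · rw [mul_div_cancel_right₀ _ htot]
  rw [hV, hA, hP]
  -- assemble
  unfold dlSrc slice
  by_cases haq : a ≤ q
  · rw [if_pos haq, if_pos haq, if_pos haq]
    by_cases hb : T ≤ 2 * (q : ℝ)
    · rw [if_pos hb, if_neg (not_lt.2 hb)]; ring
    · rw [if_neg hb, if_pos (not_le.1 hb)]; ring
  · rw [if_neg haq, if_neg haq, if_neg haq]
    by_cases hb : T ≤ 2 * (q : ℝ)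
    · rw [if_pos hb, if_neg (not_lt.2 hb)]; ring
    · rw [if_neg hb, if_pos (not_le.1 hb)]; ring

/-- **THEOREM A, core form**: the witness `dlFlow` is a flow of the slice whenever the pool-bound mass fits into the pool (`hPB`); no
second layer is mentioned — `hPB` is where (H_λ) enters (`pool_budget`), and other budgets (Theorem A⁺/C) plug in here. [this work] -/
theorem slice_isFlowAtT_of_deepLows_core (hx0 : 0 < x) (hx1 : x < 1) (hxg : x ≤ g) (hg1 : g ≤ 1)
    (ha : 1 ≤ a) (haj : a ≤ j') (hν : ∀ k, 0 ≤ ν k) (hνM : ∀ k, M < k → ν k = 0)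
    (hf0 : IsFlowAtT x T j' M ν f0) (hlam : j' ≤ lam + a)
    (hdeep : ∀ k, k ≤ j' → 2 * (k : ℝ) < T → ν k ≠ 0 → 2 * ((k : ℝ) + a) < T + (a : ℝ) * g ∧ k + a ≤ j')
    (habove : ∀ k, lam < k → k ≤ j' → ν k ≠ 0 → T + (a : ℝ) * g < 2 * (k : ℝ))
    (hPB : x / (1 - x) * ∑ l ∈ Finset.range (j' + 1), (if 2 * (l : ℝ) < T then dlRest x T g j' a ν f0 l else 0)
      ≤ dlPoolTot g j' M lam ν) :
    IsFlowAtT x (T + (a : ℝ) * g) j' (M + a) (slice ν a g) (dlFlow x T g j' M a lam ν f0) := by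
  have hg0 : 0 ≤ g := hx0.le.trans hxg
  have hpos := dl_pos x T g j' M a ν f0 hx0 hx1 hg1 hf0 hdeep
  have htot0 := dlPoolTot_nonneg g j' M lam ν hg0 hg1 hν
  -- the three pieces are nonnegative
  have hVnn : ∀ q p : ℕ, 0 ≤ (if T ≤ 2 * (q : ℝ) ∧ p = q + a then (1 - g) * ν q else 0) := fun q p => by
    split_ifs
    · exact mul_nonneg (by linarith) (hν q)
    · exact le_rfl
  have hAnn : ∀ q p : ℕ, 0 ≤ (if a ≤ q ∧ p ≤ j' then dlAd x T g j' a ν f0 (q - a) p else 0) := fun q p => by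
    split_ifs
    · exact (dlAd_nonneg_le x T g j' a ν f0 hg0 hg1 hν hpos _ _).1
    · exact le_rfl
  have hPnn : ∀ q p : ℕ, 0 ≤ dlSrc x T g j' a ν f0 q * dlPool g j' a lam ν p / dlPoolTot g j' M lam ν := fun q p =>
    div_nonneg (mul_nonneg (dlSrc_nonneg x T g j' a ν f0 hg0 hg1 hν q) (dlPool_nonneg g j' a lam ν hg0 hg1 hν p)) htot0
  refine ⟨?_, ?_, ?_, ?_⟩
  · -- nonnegativity
    intro q p
    unfold dlFlow
    by_cases hg : q ≤ j' ∧ 2 * (q : ℝ) < T + (a : ℝ) * g ∧ p ≤ M + a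
    · rw [if_pos hg]
      exact add_nonneg (add_nonneg (hVnn q p) (hAnn q p)) (hPnn q p)
    · rw [if_neg hg]
  · -- support: low source, absorber `≤ M + a`, compatibility
    intro q p hqp
    unfold dlFlow at hqp
    by_cases hg : q ≤ j' ∧ 2 * (q : ℝ) < T + (a : ℝ) * g ∧ p ≤ M + a
    · rw [if_pos hg] at hqp
      refine ⟨hg.1, hg.2.1, hg.2.2, ?_⟩
      by_cases hgi : j' + 1 ≤ p
      · exact Or.inl hgi
      · right
        have hpj : p ≤ j' := by omega
        have hP0 : dlSrc x T g j' a ν f0 q * dlPool g j' a lam ν p / dlPoolTot g j' M lam ν = 0 := by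
          rw [dlPool_eq_zero g j' a lam ν hlam p hpj, mul_zero, zero_div]
        rw [hP0, add_zero] at hqp
        by_cases hVpos : 0 < (if T ≤ 2 * (q : ℝ) ∧ p = q + a then (1 - g) * ν q else 0)
        · -- a charged vertical: `g < 1`, `p = q + a`, `T ≤ 2q`
          have hc : T ≤ 2 * (q : ℝ) ∧ p = q + a := by
            by_contra hc; rw [if_neg hc] at hVpos; exact lt_irrefl _ hVpos
          rw [if_pos hc] at hVpos
          have hg1' : g < 1 := by
            by_contra hle
            have : g = 1 := le_antisymm hg1 (not_lt.1 hle)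
            rw [this, sub_self, zero_mul] at hVpos
            exact lt_irrefl _ hVpos
          have ha' : (1 : ℝ) ≤ a := by exact_mod_cast ha
          rw [hc.2]; push_cast
          nlinarith [hc.1]
        · -- a charged anti-diagonal
          have hApos : 0 < (if a ≤ q ∧ p ≤ j' then dlAd x T g j' a ν f0 (q - a) p else 0) := by
            have := hVnn q p; linarith
          have hc : a ≤ q ∧ p ≤ j' := by
            by_contra hc; rw [if_neg hc] at hApos; exact lt_irrefl _ hApos
          rw [if_pos hc] at hApos
          have hc' : p ≤ j' ∧ 0 < f0 (q - a) p := by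
            by_contra hc'
            rw [dlAd_eq_zero x T g j' a ν f0 (q - a) p hc'] at hApos
            exact lt_irrefl _ hApos
          obtain ⟨-, -, -, hcomp, -, -, -, -⟩ := dl_geom x T g j' M a ν f0 hx0 hx1 hg1 hf0 hdeep (q - a) p hc'.1 hc'.2
          have h := antiDiag_compatible T g (q - a) p a hg1 hcomp
          rw [Nat.sub_add_cancel hc.1] at h
          exact h
    · rw [if_neg hg] at hqp
      exact absurd hqp (lt_irrefl _)
  · -- every low position is shipped exactly
    intro q hqj hq
    exact dlFlow_ships x T g j' M a lam ν f0 hx0 hx1 hxg hg1 ha haj hν hνM hf0 hPB q hqj hq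
  · -- capacity of every absorber position
    intro p hpM hc
    have e : ∀ q ∈ Finset.range (j' + 1), usage x (T + (a : ℝ) * g) j' q p * dlFlow x T g j' M a lam ν f0 q p
        = (if q ≤ j' ∧ 2 * (q : ℝ) < T + (a : ℝ) * g ∧ p ≤ M + a then
            usage x (T + (a : ℝ) * g) j' q p * (if T ≤ 2 * (q : ℝ) ∧ p = q + a then (1 - g) * ν q else 0) else 0)
          + (if q ≤ j' ∧ 2 * (q : ℝ) < T + (a : ℝ) * g ∧ p ≤ M + a then
            usage x (T + (a : ℝ) * g) j' q p * (if a ≤ q ∧ p ≤ j' then dlAd x T g j' a ν f0 (q - a) p else 0) else 0)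
          + (if q ≤ j' ∧ 2 * (q : ℝ) < T + (a : ℝ) * g ∧ p ≤ M + a then
            usage x (T + (a : ℝ) * g) j' q p *
              (dlSrc x T g j' a ν f0 q * dlPool g j' a lam ν p / dlPoolTot g j' M lam ν) else 0) := by
      intro q _
      unfold dlFlow
      split_ifs <;> ring
    rw [Finset.sum_congr rfl e, Finset.sum_add_distrib, Finset.sum_add_distrib]
    have hT2 : j' + 1 ≤ p ∨ T ≤ 2 * (p : ℝ) := by
      rcases hc with hc | hc
      · exact Or.inl hc
      · right
        have : 0 ≤ (a : ℝ) * g := mul_nonneg (Nat.cast_nonneg a) hg0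
        linarith
    have h1 := loadV_le x T g j' M a ν hx0 hxg hg1 ha hν p
    have h2 := loadA_le x T g j' M a ν f0 hx0 hx1 hg0 hg1 haj hν hf0 hdeep p hT2
    have h3 := loadP_le x T g j' M a lam ν f0 hx0 hx1 hxg hg1 ha haj hν hνM hlam hPB p hpM
    refine (add_le_add (add_le_add h1 h2) h3).trans ?_
    -- compare with the slice's mass at `p`
    have hrow0 : (if p ≤ j' then (1 - g) * ν p else 0) + (1 - g) * (if j' + 1 ≤ p then ν p else 0) = (1 - g) * ν p := by
      by_cases hpj : p ≤ j'
      · rw [if_pos hpj, if_neg (by omega)]; ring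
      · rw [if_neg hpj, if_pos (by omega)]; ring
    have hrow1 : g * (if a ≤ p ∧ p - a ≤ j' ∧ 2 * (((p - a : ℕ) : ℝ)) < T + (a : ℝ) * g then ν (p - a) else 0)
        + g * (if a ≤ p ∧ lam + 1 ≤ p - a then ν (p - a) else 0) ≤ g * (if a ≤ p then ν (p - a) else 0) := by
      have hνpa := hν (p - a)
      by_cases hap : a ≤ p
      · by_cases hl : lam + 1 ≤ p - a
        · by_cases hv : a ≤ p ∧ p - a ≤ j' ∧ 2 * (((p - a : ℕ) : ℝ)) < T + (a : ℝ) * g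
          · -- both the vertical and the row-1 pool charge `ν_{p−a}`: then `p − a` is an uncharged atom
            have hz : ν (p - a) = 0 := by
              by_contra hne
              have := habove (p - a) (by omega) hv.2.1 hne
              linarith [hv.2.2]
            rw [if_pos hv, if_pos (show a ≤ p ∧ lam + 1 ≤ p - a from ⟨hap, hl⟩), if_pos hap, hz]; linarith
          · rw [if_neg hv, if_pos (show a ≤ p ∧ lam + 1 ≤ p - a from ⟨hap, hl⟩), if_pos hap]; linarith
        · rw [if_neg (show ¬ (a ≤ p ∧ lam + 1 ≤ p - a) from fun h => hl h.2), if_pos hap]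
          split_ifs <;> nlinarith
      · rw [if_neg (show ¬ (a ≤ p ∧ p - a ≤ j' ∧ 2 * (((p - a : ℕ) : ℝ)) < T + (a : ℝ) * g) from fun h => hap h.1),
          if_neg (show ¬ (a ≤ p ∧ lam + 1 ≤ p - a) from fun h => hap h.1), if_neg hap]; linarith
    unfold dlPool slice
    linarith [hrow0, hrow1]

/-- **THEOREM A (lead g23, N49): SL-λ* FOR ANY NUMBER OF DEEP LOWS — the slice flow is a witness**, the pool budget supplied by
`pool_budget` (`g·(H_λ) + (1−g)·(H_j′)`).  See `…QuantSliceDeepLowsBudget` for the statement in words. [this work] -/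
theorem slice_isFlowAtT_of_deepLows (fl : ℕ → ℕ → ℝ) (hx0 : 0 < x) (hx1 : x < 1) (hxg : x ≤ g) (hg1 : g ≤ 1)
    (hg2 : 1 / 2 ≤ g) (ha : 1 ≤ a) (haj : a ≤ j') (hν : ∀ k, 0 ≤ ν k) (hνM : ∀ k, M < k → ν k = 0)
    (hf0 : IsFlowAtT x T j' M ν f0) (hfl : IsFlowAtT x T lam M ν fl) (hlamj : lam ≤ j') (hlam : j' ≤ lam + a)
    (hdeep : ∀ k, k ≤ j' → 2 * (k : ℝ) < T → ν k ≠ 0 → 2 * ((k : ℝ) + a) < T + (a : ℝ) * g ∧ k + a ≤ j')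
    (hbelow : ∀ k, k ≤ lam → T ≤ 2 * (k : ℝ) → ν k ≠ 0 → 2 * (k : ℝ) ≤ T + (a : ℝ) * g)
    (habove : ∀ k, lam < k → k ≤ j' → ν k ≠ 0 → T + (a : ℝ) * g < 2 * (k : ℝ)) :
    IsFlowAtT x (T + (a : ℝ) * g) j' (M + a) (slice ν a g) (dlFlow x T g j' M a lam ν f0) := by
  have hg0 : 0 ≤ g := hx0.le.trans hxg
  have hPB := pool_budget x T g j' M a ν f0 fl lam hx0 hx1 hg0 hg1 hg2 hν hf0 hfl hlamj hdeep hbelow habove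
  exact slice_isFlowAtT_of_deepLows_core x T g j' M a lam ν f0 hx0 hx1 hxg hg1 ha haj hν hνM hf0 hlam hdeep habove
    (by unfold dlPoolTot; exact hPB)

/-- **THEOREM A, flow form.** [this work] -/
theorem slice_flowAtT_of_deepLows (hx0 : 0 < x) (hx1 : x < 1) (hxg : x ≤ g) (hg1 : g ≤ 1) (hg2 : 1 / 2 ≤ g)
    (ha : 1 ≤ a) (haj : a ≤ j') (hν : ∀ k, 0 ≤ ν k) (hνM : ∀ k, M < k → ν k = 0)
    (hf0 : FlowAtT x T j' M ν) (hfl : FlowAtT x T lam M ν) (hlamj : lam ≤ j') (hlam : j' ≤ lam + a)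
    (hdeep : ∀ k, k ≤ j' → 2 * (k : ℝ) < T → ν k ≠ 0 → 2 * ((k : ℝ) + a) < T + (a : ℝ) * g ∧ k + a ≤ j')
    (hbelow : ∀ k, k ≤ lam → T ≤ 2 * (k : ℝ) → ν k ≠ 0 → 2 * (k : ℝ) ≤ T + (a : ℝ) * g)
    (habove : ∀ k, lam < k → k ≤ j' → ν k ≠ 0 → T + (a : ℝ) * g < 2 * (k : ℝ)) :
    FlowAtT x (T + (a : ℝ) * g) j' (M + a) (slice ν a g) := by
  obtain ⟨f0, hf0'⟩ := hf0
  obtain ⟨fl, hfl'⟩ := hfl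
  exact ⟨_, slice_isFlowAtT_of_deepLows x T g j' M a lam ν f0 fl hx0 hx1 hxg hg1 hg2 ha haj hν hνM hf0' hfl' hlamj hlam
    hdeep hbelow habove⟩

/-- **THEOREM A, DEC form: SL-λ* for any number of deep lows and window true mids (band atoms, giants allowed), `g ≥ 1/2`.**
For a probability law `ν` on `{0..M}`: `DECAtT x T j′ M ν ∧ DECAtT x T λ M ν ⟹ DECAtT x (T + a·g) j′ (M + a) (slice ν a g)` under the
support hypotheses of `…QuantSliceDeepLowsBudget`. [this work] -/
theorem slice_decAtT_of_deepLows (hx0 : 0 < x) (hx1 : x < 1) (hxg : x ≤ g) (hg1 : g ≤ 1) (hg2 : 1 / 2 ≤ g)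
    (ha : 1 ≤ a) (haj : a ≤ j') (hν : ∀ k, 0 ≤ ν k) (hνM : ∀ k, M < k → ν k = 0)
    (hν1 : ∑ h ∈ Finset.range (M + 1), ν h = 1)
    (hdj : DECAtT x T j' M ν) (hdl : DECAtT x T lam M ν) (hlamj : lam ≤ j') (hlam : j' ≤ lam + a)
    (hdeep : ∀ k, k ≤ j' → 2 * (k : ℝ) < T → ν k ≠ 0 → 2 * ((k : ℝ) + a) < T + (a : ℝ) * g ∧ k + a ≤ j')
    (hbelow : ∀ k, k ≤ lam → T ≤ 2 * (k : ℝ) → ν k ≠ 0 → 2 * (k : ℝ) ≤ T + (a : ℝ) * g)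
    (habove : ∀ k, lam < k → k ≤ j' → ν k ≠ 0 → T + (a : ℝ) * g < 2 * (k : ℝ)) :
    DECAtT x (T + (a : ℝ) * g) j' (M + a) (slice ν a g) := by
  have hg0 : 0 ≤ g := hx0.le.trans hxg
  refine decAtT_of_flowAtT x _ j' (M + a) (slice ν a g) hx0 hx1 (slice_eq_zero ν a g M hνM) (sum_slice ν a g M hνM hν1) ?_
  exact slice_flowAtT_of_deepLows x T g j' M a lam ν hx0 hx1 hxg hg1 hg2 ha haj hν hνM
    (flowAtT_of_decAtT x T j' M ν hx0 hx1 hdj) (flowAtT_of_decAtT x T lam M ν hx0 hx1 hdl) hlamj hlam hdeep hbelow habove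

end Main

end LawDec

end Quant

end Summit.CriticalPhenomena.PercolationContinuityZ3.Theorems
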